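import Summits.AtomisticToContinuum.Crystallization.Theses.HolmgrenBoyleLind
import Summits.AtomisticToContinuum.Crystallization.Theses.BenjaminiSchrammPeriodicSupport
import Literature.MathematicalPhysics.StatisticalMechanics.PeriodicConfigurationDelone

/-!
# Crux `HolmgrenBoyleLind.GroundStatesChargeFLCEquilibrium` (stmt-AtomisticToContinuum-6076) —
# conditional reduction of stub 1 (`stub_minimisingLawsChargeFLC`) to `PeriodicSupport`

`stub_minimisingLawsChargeFLC_of_periodicSupport`: the law-level content of the crux (every
minimising point-stationary hard-core law charges, at every scale and at ONE base point, the
patches of ONE FLC Delone set) follows from the open crux `PeriodicSupport` of the sibling route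
`BenjaminiSchrammPeriodicSupport` (the same laws charge ONE periodic configuration `Q`, base point
`q ∈ Q.points` inside the event).

Argument. The hypothesis frames agree definitionally (`IsRootedHardCore`, `IsPointStationaryLaw`,
`rootEnergy` unfold to the inlined clauses of the stub). Take `Λ := Q.points`: it is uniformly
discrete, relatively dense and of finite local complexity (`PeriodicConfiguration.exists_delone_flc`,
Literature file `PeriodicConfigurationDelone`: the patch `Λ − q` of `q = y + g` is the patch `Λ − y`
of its motif representative). (i) By the same re-basing, the `PeriodicSupport` event at
scale `(R, ε)` is contained in the finite union over the motif of the fixed-base-point events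
`E(y, R, ε)`, so by finite subadditivity some motif point `y` has `P (E(y, R, ε)) ≠ 0`; (ii) the
events are monotone (`E(y, R', ε') ⊆ E(y, R, ε)` for `R ≤ R'`, `ε' ≤ ε`); (iii) pigeonhole over the
scales `(n + 1, 1/(n + 1))`: some motif point `y₀` is charged for infinitely many `n`
(`Filter.eventually_all_finset`), hence, by (ii), at every scale. All `[folklore]` glue; helper
file for item stmt-AtomisticToContinuum-6076, nothing here closes an item.
-/

noncomputable section

open MeasureTheory Filter
open scoped ENNReal Topology

namespace Summit.AtomisticToContinuum.Crystallization.Theorems.HolmgrenBoyleLindGroundStatesChargeFLCEquilibrium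

open Literature.MathematicalPhysics.StatisticalMechanics

/-! ### The fixed-base-point matching events: monotonicity and re-basing to the motif -/

/-- **Monotonicity of the fixed-base-point matching events in the scale**: a finer matching on
a larger ball is a matching (`R ≤ R'`, `ε' ≤ ε`). The event at the FIXED base point `q`: after a
linear isometry `A`, the atoms of `ν` in the ball of radius `R` are two-way `ε`-matched with
`A((Λ − q) ∩ B_R)`. [folklore] -/
theorem baseEvent_mono (Λ : Set (EuclideanSpace ℝ (Fin 3))) (q : EuclideanSpace ℝ (Fin 3))
    {R R' ε ε' : ℝ} (hR : R ≤ R') (hε : ε' ≤ ε) :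
    {ν : Measure (EuclideanSpace ℝ (Fin 3)) |
        ∃ A : EuclideanSpace ℝ (Fin 3) →ₗᵢ[ℝ] EuclideanSpace ℝ (Fin 3),
          (∀ s ∈ Λ, dist s q ≤ R' →
            ∃ p : EuclideanSpace ℝ (Fin 3), ν {p} ≠ 0 ∧ dist p (A (s - q)) ≤ ε') ∧
          (∀ p : EuclideanSpace ℝ (Fin 3), ν {p} ≠ 0 → ‖p‖ ≤ R' →
            ∃ s ∈ Λ, dist p (A (s - q)) ≤ ε')} ⊆
      {ν : Measure (EuclideanSpace ℝ (Fin 3)) |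
        ∃ A : EuclideanSpace ℝ (Fin 3) →ₗᵢ[ℝ] EuclideanSpace ℝ (Fin 3),
          (∀ s ∈ Λ, dist s q ≤ R →
            ∃ p : EuclideanSpace ℝ (Fin 3), ν {p} ≠ 0 ∧ dist p (A (s - q)) ≤ ε) ∧
          (∀ p : EuclideanSpace ℝ (Fin 3), ν {p} ≠ 0 → ‖p‖ ≤ R →
            ∃ s ∈ Λ, dist p (A (s - q)) ≤ ε)} := by
  rintro ν ⟨A, h1, h2⟩
  exact ⟨A, fun s hs hsR => (h1 s hs (hsR.trans hR)).imp fun p hp => ⟨hp.1, hp.2.trans hε⟩,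
    fun p hp hpR => (h2 p hp (hpR.trans hR)).imp fun s hs => ⟨hs.1, hs.2.trans hε⟩⟩

/-- **Re-basing the law-level event to the motif**: for a periodic configuration `Q`, the
`PeriodicSupport` event (base point `q ∈ Q.points` inside the event) is contained in the finite
union over the motif of the fixed-base-point events. [folklore] -/
theorem periodicSupportEvent_subset (Q : PeriodicConfiguration 3) (R ε : ℝ) :
    {μ : Measure (EuclideanSpace ℝ (Fin 3)) |
      ∃ A : EuclideanSpace ℝ (Fin 3) →ₗᵢ[ℝ] EuclideanSpace ℝ (Fin 3), ∃ q ∈ Q.points,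
        (∀ s ∈ Q.points, dist s q ≤ R →
          ∃ y : EuclideanSpace ℝ (Fin 3), μ {y} ≠ 0 ∧ dist y (A (s - q)) ≤ ε) ∧
        (∀ y : EuclideanSpace ℝ (Fin 3), μ {y} ≠ 0 → ‖y‖ ≤ R →
          ∃ s ∈ Q.points, dist y (A (s - q)) ≤ ε)} ⊆
      ⋃ y ∈ Q.motif, {ν : Measure (EuclideanSpace ℝ (Fin 3)) |
        ∃ A : EuclideanSpace ℝ (Fin 3) →ₗᵢ[ℝ] EuclideanSpace ℝ (Fin 3),
          (∀ s ∈ Q.points, dist s y ≤ R →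
            ∃ p : EuclideanSpace ℝ (Fin 3), ν {p} ≠ 0 ∧ dist p (A (s - y)) ≤ ε) ∧
          (∀ p : EuclideanSpace ℝ (Fin 3), ν {p} ≠ 0 → ‖p‖ ≤ R →
            ∃ s ∈ Q.points, dist p (A (s - y)) ≤ ε)} := by
  rintro ν ⟨A, q, hq, h1, h2⟩
  obtain ⟨y, hy, g, hg, rfl⟩ := hq
  refine Set.mem_iUnion₂.2 ⟨y, hy, A, ?_, fun p hp hpR => ?_⟩
  · exact (Q.forall_points_rebase hg (fun d v => d ≤ R →
      ∃ p : EuclideanSpace ℝ (Fin 3), ν {p} ≠ 0 ∧ dist p (A v) ≤ ε)).1 h1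
  · exact (Q.exists_points_rebase hg (fun v => dist p (A v) ≤ ε)).1 (h2 p hp hpR)

/-- **Pigeonhole over a finite set along `atTop`**: if at every stage some element of a finite
set is good, then one element is good frequently. [folklore] -/
theorem exists_frequently_of_forall_exists {ι : Type*} (I : Finset ι) {p : ι → ℕ → Prop}
    (h : ∀ n : ℕ, ∃ i ∈ I, p i n) : ∃ i ∈ I, ∃ᶠ n : ℕ in atTop, p i n := by
  by_contra hno
  have hev : ∀ᶠ n : ℕ in atTop, ∀ i ∈ I, ¬ p i n :=
    (Filter.eventually_all_finset I).2 fun i hi =>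
      Filter.not_frequently.1 fun hf => hno ⟨i, hi, hf⟩
  obtain ⟨n, hn⟩ := hev.exists
  obtain ⟨i, hi, hpi⟩ := h n
  exact hn i hi hpi

/-- **Scales `(n + 1, 1/(n + 1))` are cofinal**: for `R, ε > 0` and `n₀ ≥ max R (1/ε)`, every
`m ≥ n₀` has `R ≤ m + 1` and `1/(m + 1) ≤ ε`. [folklore] -/
theorem scale_le_of_le {R ε : ℝ} (hε : 0 < ε) {n₀ m : ℕ} (hn₀ : max R (1 / ε) ≤ n₀)
    (hm : n₀ ≤ m) : R ≤ (m : ℝ) + 1 ∧ 1 / ((m : ℝ) + 1) ≤ ε := by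
  have hm' : (n₀ : ℝ) ≤ m := Nat.cast_le.2 hm
  refine ⟨by linarith [le_max_left R (1 / ε)], ?_⟩
  have h1 : 1 / ε ≤ (m : ℝ) + 1 := by linarith [le_max_right R (1 / ε)]
  exact (one_div_le (by positivity) hε).2 h1

/-- **Stub 1 of the skeleton from `PeriodicSupport`** (conditional reduction to the open crux of
route `BenjaminiSchrammPeriodicSupport`). Every minimising point-stationary hard-core law `P`
charges, at every scale `(R, ε)` and at ONE base point `q₀`, the patches of ONE `δ'`-separated,
`r`-dense set `Λ` of finite local complexity — granted that such laws charge one periodic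
configuration `Q` (`PeriodicSupport`): `Λ := Q.points`, `q₀ :=` a motif point charged at
infinitely many of the scales `(n + 1, 1/(n + 1))` (finite subadditivity over the motif after
re-basing, pigeonhole, monotonicity of the events). [folklore] -/
theorem stub_minimisingLawsChargeFLC_of_periodicSupport :
    Summit.AtomisticToContinuum.Crystallization.Theses.BenjaminiSchrammPeriodicSupport.PeriodicSupport →
    ∀ δ : ℝ, 0 < δ → ∀ P : Measure (Measure (EuclideanSpace ℝ (Fin 3))), IsProbabilityMeasure P →
      (∀ᵐ μ ∂P, (∃ S : Set (EuclideanSpace ℝ (Fin 3)), (0 : EuclideanSpace ℝ (Fin 3)) ∈ S ∧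
        (∀ x ∈ S, ∀ y ∈ S, x ≠ y → δ ≤ dist x y) ∧
        μ = (Measure.count : Measure (EuclideanSpace ℝ (Fin 3))).restrict S)) →
      (∀ g : Measure (EuclideanSpace ℝ (Fin 3)) → EuclideanSpace ℝ (Fin 3) → ENNReal,
        Measurable (Function.uncurry g) →
        ∫⁻ μ, ∫⁻ y, g μ y ∂μ ∂P = ∫⁻ μ, ∫⁻ y, g (Measure.map (fun z => z - y) μ) (-y) ∂μ ∂P) →
      (∫ μ, (∫ y, lennardJones ‖y‖ ∂μ) / 2 ∂P) ≤
        (⨅ Q : PeriodicConfiguration 3, Q.energyPerParticle lennardJones) →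
      ∃ (Λ : Set (EuclideanSpace ℝ (Fin 3))) (δ' r : ℝ), 0 < δ' ∧ 0 < r ∧
        (∀ x ∈ Λ, ∀ y ∈ Λ, x ≠ y → δ' ≤ dist x y) ∧
        (∀ c : EuclideanSpace ℝ (Fin 3), ∃ y ∈ Λ, dist y c ≤ r) ∧
        (∀ R : ℝ, Set.Finite {S : Set (EuclideanSpace ℝ (Fin 3)) |
          ∃ x ∈ Λ, S = {v : EuclideanSpace ℝ (Fin 3) | x + v ∈ Λ ∧ ‖v‖ ≤ R}}) ∧
        ∃ q₀ ∈ Λ, ∀ R ε : ℝ, 0 < R → 0 < ε →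
          P {ν : Measure (EuclideanSpace ℝ (Fin 3)) |
              ∃ A : EuclideanSpace ℝ (Fin 3) →ₗᵢ[ℝ] EuclideanSpace ℝ (Fin 3),
                (∀ s ∈ Λ, dist s q₀ ≤ R →
                  ∃ p : EuclideanSpace ℝ (Fin 3), ν {p} ≠ 0 ∧ dist p (A (s - q₀)) ≤ ε) ∧
                (∀ p : EuclideanSpace ℝ (Fin 3), ν {p} ≠ 0 → ‖p‖ ≤ R →
                  ∃ s ∈ Λ, dist p (A (s - q₀)) ≤ ε)} ≠ 0 := by
  intro hPS δ hδ P hP hcore hstat hmin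
  -- fold the inlined frame into the three landed notions of `PeriodicSupport`
  have hcore' : ∀ᵐ μ ∂P, Literature.Probability.Process.IsRootedHardCore δ μ := hcore
  have hstat' : Literature.Probability.Process.IsPointStationaryLaw P := hstat
  have hmin' : (∫ μ, rootEnergy lennardJones μ ∂P) ≤
      ⨅ Q : PeriodicConfiguration 3, Q.energyPerParticle lennardJones := hmin
  -- ONE periodic configuration charged at every scale (base point inside the event)
  obtain ⟨Q, hQ⟩ := hPS δ hδ P hP hcore' hstat' hmin'
  obtain ⟨δ', r, hδ', hr, hsep, hden, hflc⟩ := Q.exists_delone_flc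
  -- the fixed-base-point events
  set E : EuclideanSpace ℝ (Fin 3) → ℝ → ℝ → Set (Measure (EuclideanSpace ℝ (Fin 3))) :=
    fun q R ε => {ν : Measure (EuclideanSpace ℝ (Fin 3)) |
        ∃ A : EuclideanSpace ℝ (Fin 3) →ₗᵢ[ℝ] EuclideanSpace ℝ (Fin 3),
          (∀ s ∈ Q.points, dist s q ≤ R →
            ∃ p : EuclideanSpace ℝ (Fin 3), ν {p} ≠ 0 ∧ dist p (A (s - q)) ≤ ε) ∧
          (∀ p : EuclideanSpace ℝ (Fin 3), ν {p} ≠ 0 → ‖p‖ ≤ R →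
            ∃ s ∈ Q.points, dist p (A (s - q)) ≤ ε)} with hE
  -- (i) at every scale some motif point is charged
  have hstep : ∀ R ε : ℝ, 0 < R → 0 < ε → ∃ y ∈ Q.motif, P (E y R ε) ≠ 0 := by
    intro R ε hR hε
    have hpos := hQ R ε hR hε
    by_contra hall
    push Not at hall
    have hzero : P (⋃ y ∈ Q.motif, E y R ε) = 0 :=
      nonpos_iff_eq_zero.1 ((measure_biUnion_finset_le Q.motif _).trans
        (Finset.sum_eq_zero fun y hy => hall y hy).le)
    exact hpos.ne' (measure_mono_null (periodicSupportEvent_subset Q R ε) hzero)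
  -- (iii) pigeonhole over the scales `(n + 1, 1/(n + 1))`
  obtain ⟨y₀, hy₀, hfr⟩ := exists_frequently_of_forall_exists Q.motif
    (p := fun y n => P (E y ((n : ℝ) + 1) (1 / ((n : ℝ) + 1))) ≠ 0)
    fun n => hstep ((n : ℝ) + 1) (1 / ((n : ℝ) + 1)) (by positivity) (by positivity)
  refine ⟨Q.points, δ', r, hδ', hr, hsep, hden, hflc, y₀, Q.mem_points_of_mem_motif hy₀, ?_⟩
  -- (ii) monotonicity: charged at a finer cofinal scale ⇒ charged at `(R, ε)`
  intro R ε _hR hε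
  obtain ⟨n₀, hn₀⟩ := exists_nat_ge (max R (1 / ε))
  obtain ⟨m, hm, hmE⟩ := Filter.frequently_atTop.1 hfr n₀
  obtain ⟨hRm, hεm⟩ := scale_le_of_le hε hn₀ hm
  exact fun h0 => hmE (measure_mono_null (baseEvent_mono Q.points y₀ hRm hεm) h0)

end Summit.AtomisticToContinuum.Crystallization.Theorems.HolmgrenBoyleLindGroundStatesChargeFLCEquilibrium

end
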